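import Summits.BirchSwinnertonDyer.BirchSwinnertonDyer.Theorems.PrintCf2RubinValueTwoColemanCoinvariantCharTraceEllipticUnitsFrameDischarged
import Literature.NumberTheory.GaloisRepresentations.LocalFieldNatCastDense
import Literature.NumberTheory.GaloisRepresentations.LocalGaloisGroupFrobeniusProofs
import Literature.NumberTheory.NumberFields.AdicCompletionIntegersPadicIntOfDegreeOne
import Literature.NumberTheory.NumberFields.AdicCompletionResidueCardUniformizerOfPadicIntEquiv
import Literature.NumberTheory.NumberFields.RayClassFieldSplitPrimePowerDegreeQuadratic
import HarnessLib

/-!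
# Brick (c) at `p = 2`: the frame-discharged (c)-capstone (T14) with ALL local binders at `v` AND `v̄` discharged from the CRUX'S OWN hypotheses
# (`[K:ℚ] = 2`, `2 ∈ v`, `2 ∈ v̄`, `v̄ ≠ v` ⟹ both places have degree one, `K_v ≅ ℚ₂`): `#𝓀(K_v) = 2`, `2` a uniformiser, `char K_v = 0`, an
# arithmetic Frobenius `σ₀`, `(2)`-adic completeness of `𝒪_{K_v}`, `(2) ≠ ⊤`, `ℕ` dense in `𝒪_{K_v}`, `#𝓞/v̄ = 2`, `2 ∉ v̄²`, and `w_{𝔤₀} = 1` from `2 ∉ 𝔤₀`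

Cell `bsd-print-cf2`, width seat `bsd-line-cf2c-w7` g19, route C `PrintCf2RubinValueTwo`, crux of record stmt-BirchSwinnertonDyer-24033
`TwoVariableMainConjAtSplitTwoQuad` (23720 nominal), BRICK §4(c); `--supports` the crux as a helper.  THEOREMS ONLY (0 sorry, no named fact
asserted, no definition); CONDITIONAL on the published named facts `DeShalit1987.prop24_ii/iii`, `prop25_i` carried as hypotheses by the
elliptic-unit files.  Theses-free.  BSD is not proved by any of this.

T14 (`…FrameDischarged`) still displays, at the place `v`, the local analytic binders of memo BRICK-C-KERNEL-g18 F17: `[CharZero K_v]`, `σ₀` with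
`IsAbsArithFrob σ₀`, `hq : #𝓀(K_v) = 2`, `h2 : 2` a uniformiser, `[IsAdicComplete (2) 𝒪_{K_v}]`, `hI : (2) ≠ ⊤`, `hN : ℕ` dense in `𝒪_{K_v}`, and at
`v̄` the elementary `hdeg1 : #𝓞/v̄ = 2`, `hpv'2 : 2 ∉ v̄²`, and `hw𝔤 : w_{𝔤₀} = 1`.  For an imaginary quadratic `K` with `2 ∈ v`, `2 ∈ v̄`, `v̄ ≠ v` (the
crux's hypotheses) both places have degree one (`padicIntEquivOfSplit`: `𝒪_v ≅ ℤ₂`; `natCard_quotient_eq_of_mem_of_mem_of_ne`,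
`natCast_not_mem_sq_of_mem_of_mem_of_ne`), whence `hq`/`h2` (`residueFieldCard_adicCompletion_of_padicIntEquiv`,
`isUniformizer_natCast_adicCompletion_of_padicIntEquiv`), `σ₀` (`exists_isAbsArithFrob_holds`), Mathlib's `IsAdicComplete 𝓂 𝒪` with `𝓂 = (2)`,
`hN` (`LocalFieldNatCastDense`, this seat), and `hw𝔤` from `2 ∉ 𝔤₀` (units are torsion, hence `±1` in `K_v`: `RayClassFieldTwoVariableFrameGenerator`).
THIS file moves all of them from the hypotheses into the existential prefix:

* ★★★ `exists_frame_charIdeal_coinvariants_colemanImageTrace_closure_ellipticUnits_eq_span_of_ellipticUnits_moment_of_split`.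

## References
* [deShalit1987] E. de Shalit, *Iwasawa theory of elliptic curves with complex multiplication* (1987), I §1.1–1.3, §3.3, §3.5 (11); II §1.1, §1.10,
  §4.9–4.10, §4.12, §4.14, §4.17; III §1.3–1.4, 1.10.
* [NeukirchANT1999] J. Neukirch, *Algebraic Number Theory* (1999), Ch. I §7, Ch. II §4, Ch. VI §7.
* [SerreLocalFields1979] J.-P. Serre, *Local Fields* (1979), Ch. I §1, Ch. II §4.
-/

noncomputable section

set_option linter.dupNamespace false
set_option autoImplicit false

open Filter Topology
open scoped PowerSeries.WithPiTopology
open scoped NumberField Classical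

namespace Summit.BirchSwinnertonDyer.BirchSwinnertonDyer.Theorems.PrintCf2.ColemanCoinvariantTraceEllipticUnitsFrameDischargedSplit

open Field IsDedekindDomain IsDedekindDomain.HeightOneSpectrum ValuativeRel WithZero
open Literature.NumberTheory.NumberFields
open Literature.NumberTheory.GaloisRepresentations Literature.NumberTheory.GaloisRepresentations.IsNonarchimedeanLocalField
  Literature.NumberTheory.GaloisRepresentations.LubinTate Literature.NumberTheory.GaloisRepresentations.ArtinLocalGlobal
open Literature.NumberTheory.EllipticCurves
open Literature.NumberTheory.ComplexMultiplication.EllipticUnits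
open Literature.NumberTheory.LFunctions.AbelianDensity (artinSymbol)
open Literature.RingTheory.PowerSeries (maxEval)
open Summit.BirchSwinnertonDyer.BirchSwinnertonDyer.Theorems.PrintCf2.ColemanImage
open Summit.BirchSwinnertonDyer.BirchSwinnertonDyer.Theorems.PrintCf2.ColemanCoinvariantGalois
open Summit.BirchSwinnertonDyer.BirchSwinnertonDyer.Theorems.PrintCf2.ColemanCoinvariantArtin
open Summit.BirchSwinnertonDyer.BirchSwinnertonDyer.Theorems.PrintCf2.EllipticUnitsLocal
open Summit.BirchSwinnertonDyer.BirchSwinnertonDyer.Theorems.PrintCf2.EllipticUnitsLocal₂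
open Summit.BirchSwinnertonDyer.BirchSwinnertonDyer.Theorems.PrintCf2.ColemanCoinvariantEllipticUnits
open Summit.BirchSwinnertonDyer.BirchSwinnertonDyer.Theorems.PrintCf2.ColemanCoinvariantEllipticUnitsLiftable
open Summit.BirchSwinnertonDyer.BirchSwinnertonDyer.Theorems.PrintCf2.ColemanCoinvariantTrace
open Summit.BirchSwinnertonDyer.BirchSwinnertonDyer.Theorems.PrintCf2.ColemanCoinvariantTraceEllipticUnits
open Summit.BirchSwinnertonDyer.BirchSwinnertonDyer.Theorems.PrintCf2.ColemanCoinvariantTraceEllipticUnitsTowerDataOffset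
open Summit.BirchSwinnertonDyer.BirchSwinnertonDyer.Theorems.PrintCf2.ColemanCoinvariantTraceEllipticUnitsTowerDataOffsetIndex
open Summit.BirchSwinnertonDyer.BirchSwinnertonDyer.Theorems.PrintCf2.ColemanCoinvariantTraceEllipticUnitsTowerDataOffsetMoment

open Summit.BirchSwinnertonDyer.BirchSwinnertonDyer.Theorems.PrintCf2.ColemanCoinvariantTraceEllipticUnitsTowerDataOffsetLevelEllipticMoment
open Summit.BirchSwinnertonDyer.BirchSwinnertonDyer.Theorems.PrintCf2.ColemanCoinvariantTraceEllipticUnitsFrameDischarged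

variable {K : Type} [Field K] [NumberField K] {𝔤₀ : Ideal (𝓞 K)} {v v' : HeightOneSpectrum (𝓞 K)}

attribute [local instance] ltNormUniformSpace ltNormIsUniformAddGroup rk1 nF nE fintypeResidueField
attribute [local instance] RelNormCoherentUnits.instCommMonoid

/-- `v ∤ 𝔤₀v'^ν` for `v ∤ 𝔤₀`, `v ≠ v'`. [cite: deShalit1987, II.4.14 (p. 71)] -/
private theorem not_mul_pow_le₃₂ (hv : ¬ 𝔤₀ ≤ v.asIdeal) (hvv' : v' ≠ v) (n : ℕ) : ¬ 𝔤₀ * v'.asIdeal ^ n ≤ v.asIdeal := by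
  intro h
  rcases (v.isPrime.mul_le).mp h with h1 | h2
  · exact hv h1
  · rcases n with _ | n
    · rw [pow_zero, Ideal.one_eq_top, top_le_iff] at h2
      exact v.isPrime.ne_top h2
    · exact hvv' (HeightOneSpectrum.ext ((v'.isMaximal.eq_of_le v.isPrime.ne_top ((Ideal.IsPrime.pow_le_iff (hP := v.isPrime)
        (Nat.succ_ne_zero n)).mp h2))))

section Capstone

attribute [local instance] isAdicComplete_maximalIdeal_powerSeries_integer

variable [NumberField.IsTotallyComplex K]
  (h24iii : DeShalit1987.prop24_iii_unit) (h25 : DeShalit1987.prop25_i_normRelation) (h24ii : DeShalit1987.prop24_ii_galoisAction)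

include h24iii h25 h24ii in
/-- ★★★ **THE (c)-CAPSTONE WITH ITS COLEMAN FRAME AND ALL LOCAL BINDERS DISCHARGED FROM THE CRUX'S HYPOTHESES.**  As
`…FrameDischarged.exists_frame_…` (T14), for `K` imaginary quadratic of ODD class number, `2 ∈ v`, `2 ∈ v̄`, `v̄ ≠ v` (so both places have degree
one), and a conductor `𝔤₀ ≠ 0` prime to `v, v̄` with `2 ∉ 𝔤₀`; the existential prefix now ALSO supplies `w_{𝔤₀} = 1`, `#𝓞/v̄ = 2`, `2 ∉ v̄²`,
`char K_v = 0`, an arithmetic Frobenius `σ₀`, `#𝓀(K_v) = 2`, the `(2)`-adic completeness of `𝒪_{K_v}`, `(2) ≠ ⊤` and the density of `ℕ` in `𝒪_{K_v}`,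
besides the Coleman frame (`π`, `α = π^f`, `ℓ = ν`, `d₀`, `r`, `u`, …).  Conclusion (for all free data and the two numeric inputs):
**`char_Λ((N_Σ/Col_Σ 𝒞̄_ell)_ε) = (L)`**. [cite: deShalit1987, I §1.1–1.3, §3.3, §3.5 (11); II §1.1, §1.10, §2.4 (ii), §4.9–4.10, §4.12 (29)–(33), §4.14,
§4.17; III §1.3, §1.4 (5), Cor. 1.5, Lemma 1.10 (17)] [cite: NeukirchANT1999, Ch. I §7, Ch. II §4 Prop. (4.3), Ch. VI §7 Thm. (7.1)]
[cite: SerreLocalFields1979, Ch. II §4 Prop. 8] -/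
theorem exists_frame_charIdeal_coinvariants_colemanImageTrace_closure_ellipticUnits_eq_span_of_ellipticUnits_moment_of_split
    (hK : IsImaginaryQuadratic K) (ιK : K →+* ℂ)
    (h𝔤0 : 𝔤₀ ≠ ⊥) (hv : ¬ 𝔤₀ ≤ v.asIdeal) (hv' : ¬ 𝔤₀ ≤ v'.asIdeal) (hvv' : v' ≠ v) (h2𝔤 : (2 : 𝓞 K) ∉ 𝔤₀)
    {p : ℕ} [hp : Fact p.Prime] (hp2 : p = 2) (hpv : (p : 𝓞 K) ∈ v.asIdeal) (hpv' : (p : 𝓞 K) ∈ v'.asIdeal)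
    (hcl : ¬ 2 ∣ NumberField.classNumber K) :
    ∃ (hw𝔤 : ∀ u : (𝓞 K)ˣ, (u : 𝓞 K) - 1 ∈ 𝔤₀ → u = 1) (hdeg1 : Nat.card (𝓞 K ⧸ v'.asIdeal) = p) (hpv'2 : (p : 𝓞 K) ∉ v'.asIdeal ^ 2)
      (_ : CharZero (v.adicCompletion K)) (σ₀ : absoluteGaloisGroup (v.adicCompletion K)) (hσ₀ : IsAbsArithFrob σ₀)
      (hq : residueFieldCard (v.adicCompletion K) = 2)
      (_ : IsAdicComplete (Ideal.span {(p : 𝒪[v.adicCompletion K])}) 𝒪[v.adicCompletion K])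
      (hI : Ideal.span {(p : 𝒪[v.adicCompletion K])} ≠ ⊤) (hN : DenseRange (Nat.cast : ℕ → 𝒪[v.adicCompletion K]))
      (π : 𝒪[v.adicCompletion K]) (hπ : (valuation (v.adicCompletion K)).IsUniformizer (π : v.adicCompletion K))
      (α : 𝓞 K) (hα0 : α ≠ 0) (hα𝔤 : α - 1 ∈ 𝔤₀) (hαw : ∀ w : HeightOneSpectrum (𝓞 K), w ≠ v → α ∉ w.asIdeal)
      (f : ℕ) (hαf : Ideal.span {α} = v.asIdeal ^ f) (hαπ : ((α : K) : v.adicCompletion K) = (π : v.adicCompletion K) ^ f)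
      (ℓ ν : ℕ) (hℓ : 1 ≤ ℓ) (hαℓ : v'.intValuation (α - 1) = exp (-(ℓ : ℤ)))
      (ha2 : 2 ≤ ν + 1 ∨ p ≠ 2) (hαa : v'.intValuation (α ^ p - 1) = exp (-((ν + 1 : ℕ) : ℤ)))
      (d₀ r : ℕ) (hd : d₀.Coprime p) (hf : f = d₀ * p ^ r) (hfo : f ∣ orderOf (galFrob K (rayClassField K (𝔤₀ * v'.asIdeal ^ ν)) v))
      (u : (LTCoeff (v.adicCompletion K))ˣ) (hu : LTCoeff.of (v.adicCompletion K) π = residueFieldCard (v.adicCompletion K) * u)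
      (_ : NeZero d₀)
      (_ : ∃ m₁ : ℕ, LTCoeff.of (v.adicCompletion K) π ^ 2 ∣ LTCoeff.of (v.adicCompletion K) π - m₁),
    ∀ (E : ℕ → IntermediateField (v.adicCompletion K) (AlgebraicClosure (v.adicCompletion K)))
      [∀ j, FiniteDimensional (v.adicCompletion K) (E j)] [∀ j, Normal (v.adicCompletion K) (E j)] [∀ j, IsGalois (v.adicCompletion K) (E j)]
      (hmono : Monotone E) (hE : ∀ j, E j ≤ maxUnramified (v.adicCompletion K)) (hdeg : ∀ j, Module.finrank (v.adicCompletion K) (E j) = d₀ * p ^ j)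
      (γ w : 𝒪[v.adicCompletion K]ˣ) (hγ : (γ : 𝒪[v.adicCompletion K]) = 1 + π ^ 2 * w)
      [IsAdicComplete (Ideal.span {intBase (v.adicCompletion K) (LTCoeff.of (v.adicCompletion K) π)}) (PowerSeries 𝒪[v.adicCompletion K])]
      {θ : ∀ j, unitBall (E j)} (hθ : ∀ j, IsIntegralNormalGen (E j) (θ j))
      (hcoh : ∀ j, unitBallTrace (hmono (Nat.le_succ j)) (θ (j + 1)) = θ j)
      (hud : ∀ j, (u : LTCoeff (v.adicCompletion K)) ^ Module.finrank (v.adicCompletion K) (E j) ≠ 1)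
      (x : ∀ a : {𝔞 : Ideal (𝓞 K) // IsLocArtinLiftable (𝔤₀ * v'.asIdeal ^ ν) v v' 𝔞}, ∀ i k : ℕ,
        rayClassField K (𝔤₀ * v'.asIdeal ^ ν * v'.asIdeal ^ (i + 1) * v.asIdeal ^ (k + 1)))
      (hx : ∀ a, ∀ i k : ℕ, IsThetaValueOne ιK (𝔤₀ * v'.asIdeal ^ ν * v'.asIdeal ^ (i + 1) * v.asIdeal ^ (k + 1)) (a.1 : Ideal (𝓞 K))
        (algClosureEmb ιK ((x a i k : rayClassField K (𝔤₀ * v'.asIdeal ^ ν * v'.asIdeal ^ (i + 1) * v.asIdeal ^ (k + 1))) : AlgebraicClosure K)))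
      (σ : {𝔞 : Ideal (𝓞 K) // IsLocArtinLiftable (𝔤₀ * v'.asIdeal ^ ν) v v' 𝔞} → absoluteGaloisGroup (v.adicCompletion K))
      (hσ : ∀ a, ∀ i k : ℕ, absRestrictNormalHom (rayClassField K (𝔤₀ * v'.asIdeal ^ ν * v'.asIdeal ^ (i + 1) * v.asIdeal ^ (k + 1)))
          (absGaloisRestrict K (v.adicCompletion K) (σ a)) =
        artinSymbol (galFrob K (rayClassField K (𝔤₀ * v'.asIdeal ^ ν * v'.asIdeal ^ (i + 1) * v.asIdeal ^ (k + 1)))) (a.1 : Ideal (𝓞 K)))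
      (ε : PowerSeries (PowerSeries 𝒪[v.adicCompletion K]))
      (g : {𝔞 : Ideal (𝓞 K) // IsLocArtinLiftable (𝔤₀ * v'.asIdeal ^ ν) v v' 𝔞} → (PowerSeries 𝒪[v.adicCompletion K])ˣ)
      (hε : ε * ε = 1)
    (a₁ a₂ : {𝔞 : Ideal (𝓞 K) // IsLocArtinLiftable (𝔤₀ * v'.asIdeal ^ ν) v v' 𝔞}) (hv₁ : lubinTateChar hπ (σ a₁) = γ)
    (hn₁ : ((Ideal.absNorm (a₁.1 : Ideal (𝓞 K)) : ℕ) : PowerSeries 𝒪[v.adicCompletion K]) * ((g a₁)⁻¹ : (PowerSeries 𝒪[v.adicCompletion K])ˣ) - 1 ∈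
      IsLocalRing.maximalIdeal (PowerSeries 𝒪[v.adicCompletion K]))
    (hg₁ : PowerSeries.constantCoeff (g a₁ : PowerSeries 𝒪[v.adicCompletion K]) = 1)
    (hg₂ : PowerSeries.constantCoeff (g a₂ : PowerSeries 𝒪[v.adicCompletion K]) = 1)
    (hn₁π : π ^ 2 ∣ ((Ideal.absNorm (a₁.1 : Ideal (𝓞 K)) : ℕ) : 𝒪[v.adicCompletion K]) - 1)
    {m : ℕ} (hne : ((Ideal.absNorm (a₁.1 : Ideal (𝓞 K)) : ℕ) : 𝒪[v.adicCompletion K]) ≠ (γ : 𝒪[v.adicCompletion K]) ^ m)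
    (hn₂ : ((Ideal.absNorm (a₂.1 : Ideal (𝓞 K)) : ℕ) : 𝒪[v.adicCompletion K]) = (lubinTateChar hπ (σ a₂) : 𝒪[v.adicCompletion K]) ^ m)
    (hv₂ : lubinTateChar hπ (σ a₂) ≠ 1) (hv₂' : lubinTateChar hπ (σ a₂) ≠ -1)
    (mm kk : ℕ) [IsAdicComplete (Ideal.span {algebraMap (LTCoeff (v.adicCompletion K)) (unitBall (E mm)) (LTCoeff.of (v.adicCompletion K) π)})
      (unitBall (E mm))]
    (hεk : PowerSeries.map ((algebraMap 𝒪[v.adicCompletion K] (unitBall (E mm))).comp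
      (PowerSeries.constantCoeff (R := 𝒪[v.adicCompletion K]))) ε = (-1) ^ (kk + 1))
    (hmom : ∑ τ : E mm ≃ₐ[v.adicCompletion K] E mm, unitBallEquiv (E mm) τ (coordMoment hπ (E mm) u kk
      (relUnitCoordTwo hπ (E mm) hq (hE mm) hσ₀ u hu
        (extendDown hπ E hmono (r + 1) (ellipticUnitsLocal₂ h24iii h25 hK ιK
                    (mul_ne_zero h𝔤0 (pow_ne_zero ν v'.ne_bot))
                    (not_mul_pow_le₃₂ hv hvv' ν) hvv'
                    (hw_of_towerData hw𝔤) hπ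
                    (towerData_hα0 (p := p) hα0)
                    (towerData_hα𝔪 hv' hp.out hpv' hpv'2 hα𝔤 ha2 hαa)
                    (towerData_hαw (p := p) hαw)
                    (towerData_hαπ (p := p) hαπ) (fun i ↦ E (i + (r + 1)))
                  (fun i ↦ hE (i + (r + 1)))
                      (towerDataOffset_hdegE hf E hE hdeg) a₁.2.1 a₁.2.2.1 (x a₁) (hx a₁)) mm))) ≠ 0)
    (L : PowerSeries (PowerSeries 𝒪[v.adicCompletion K]))
    (hL : ∀ b : {𝔞 : Ideal (𝓞 K) // IsLocArtinLiftable (𝔤₀ * v'.asIdeal ^ ν) v v' 𝔞}, colemanDeltaCoinvFun hπ hq (intBase (v.adicCompletion K)) u hu γ (eq_zero_of_C_pi_mul_eq_zero_integer hπ) w hγ ε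
        (indexTraceₗ hπ hq u hu γ (colemanImage hd hπ E hmono hE hdeg hσ₀ hq u hu γ hθ hcoh
          (closure_unitsGen_subset_principalCoherentFamilies hπ E hmono
            (fun b ↦ ellipticUnitsPrincipal₂ h24iii h25 hK ιK
                (mul_ne_zero h𝔤0 (pow_ne_zero ν v'.ne_bot))
                (not_mul_pow_le₃₂ hv hvv' ν) hvv'
                (hw_of_towerData hw𝔤) hπ
                (towerData_hα0 (p := p) hα0)
                (towerData_hα𝔪 hv' hp.out hpv' hpv'2 hα𝔤 ha2 hαa)
                (towerData_hαw (p := p) hαw)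
                (towerData_hαπ (p := p) hαπ) E hmono (r + 1) (fun i ↦ hE (i + (r + 1)))
                (towerDataOffset_hdegE hf E hE hdeg)
              b.2.1 b.2.2.1 (x b) (hx b))
            (fun b ↦ ellipticUnitsPrincipal₂_mem_principalCoherentFamilies h24iii h25 hK ιK
                (mul_ne_zero h𝔤0 (pow_ne_zero ν v'.ne_bot))
                (not_mul_pow_le₃₂ hv hvv' ν) hvv'
                (hw_of_towerData hw𝔤) hπ
                (towerData_hα0 (p := p) hα0)
                (towerData_hα𝔪 hv' hp.out hpv' hpv'2 hα𝔤 ha2 hαa)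
                (towerData_hαw (p := p) hαw)
                (towerData_hαπ (p := p) hαπ) E hmono (r + 1)
              (fun i ↦ hE (i + (r + 1)))
                  (towerDataOffset_hdegE hf E hE hdeg) b.2.1 b.2.2.1 (fun i ↦
                  (towerDataOffset_hinert_of_level h𝔤0 hv hv' hvv' hw𝔤 hp.out hpv' hpv'2 hπ hα0 hα𝔤 hαf hℓ hαℓ ha2 hαa hfo E hE (r + 1) (finrank_add_offset_eq E hf hdeg)) (i + 1))
                  (towerDataOffset_hcount h𝔤0 hv' hvv' hw𝔤 hp.out hdeg1 hpv' hpv'2 E hdeg) (x b) (hx b))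
            (mem_closure_unitsGen hπ E _ b)).1)) =
      (colemanDeltaCoinvFun hπ hq (intBase (v.adicCompletion K)) u hu γ (eq_zero_of_C_pi_mul_eq_zero_integer hπ) w hγ ε
          (unitTwistₗ hπ hq (intBase (v.adicCompletion K)) u hu γ (lubinTateChar hπ (σ b)) (TActModule.ofPS _ _ 1)) *
          PowerSeries.C (g b : PowerSeries 𝒪[v.adicCompletion K]) - PowerSeries.C ((Ideal.absNorm (b.1 : Ideal (𝓞 K)) : ℕ) : PowerSeries 𝒪[v.adicCompletion K])) * L),
        Module.charIdeal (PowerSeries (PowerSeries 𝒪[v.adicCompletion K]))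
        (↥(unitsImageTrace hd hπ E hmono hE hdeg hσ₀ hq u hu γ hθ hcoh hI hud) ⧸
          colemanCoinvRel hπ hq (intBase (v.adicCompletion K)) u hu γ ε (unitsImageTrace hd hπ E hmono hE hdeg hσ₀ hq u hu γ hθ hcoh hI hud)
            (fun _ hG => unitTwistₗ_mem_unitsImageTrace hd hπ E hmono hE hdeg hσ₀ hq u hu γ hθ hcoh hI hud (-1) hG)
            (colemanImageTrace hd hπ E hmono hE hdeg hσ₀ hq u hu γ hθ hcoh hN
              (closure (Submonoid.closure
                (Set.range (fun b ↦ ellipticUnitsPrincipal₂ h24iii h25 hK ιK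
                    (mul_ne_zero h𝔤0 (pow_ne_zero ν v'.ne_bot))
                    (not_mul_pow_le₃₂ hv hvv' ν) hvv'
                    (hw_of_towerData hw𝔤) hπ
                    (towerData_hα0 (p := p) hα0)
                    (towerData_hα𝔪 hv' hp.out hpv' hpv'2 hα𝔤 ha2 hαa)
                    (towerData_hαw (p := p) hαw)
                    (towerData_hαπ (p := p) hαπ) E hmono (r + 1) (fun i ↦ hE (i + (r + 1)))
                  (towerDataOffset_hdegE hf E hE hdeg) b.2.1 b.2.2.1 (x b) (hx b)) ∪
                  Set.range fun b ↦ fun j ↦ (ellipticUnitsPrincipal₂ h24iii h25 hK ιK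
                      (mul_ne_zero h𝔤0 (pow_ne_zero ν v'.ne_bot))
                      (not_mul_pow_le₃₂ hv hvv' ν) hvv'
                      (hw_of_towerData hw𝔤) hπ
                      (towerData_hα0 (p := p) hα0)
                      (towerData_hα𝔪 hv' hp.out hpv' hpv'2 hα𝔤 ha2 hαa)
                      (towerData_hαw (p := p) hαw)
                      (towerData_hαπ (p := p) hαπ) E hmono (r + 1)
                    (fun i ↦ hE (i + (r + 1))) (towerDataOffset_hdegE hf E hE hdeg) b.2.1 b.2.2.1 (x b) (hx b) j).inv hπ (E j)) :
                Set (∀ j, RelNormCoherentUnits hπ (E j))))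
              isClosed_closure
              (closure_unitsGen_subset_principalCoherentFamilies hπ E hmono _
                (fun b ↦ ellipticUnitsPrincipal₂_mem_principalCoherentFamilies h24iii h25 hK ιK
                    (mul_ne_zero h𝔤0 (pow_ne_zero ν v'.ne_bot))
                    (not_mul_pow_le₃₂ hv hvv' ν) hvv'
                    (hw_of_towerData hw𝔤) hπ
                    (towerData_hα0 (p := p) hα0)
                    (towerData_hα𝔪 hv' hp.out hpv' hpv'2 hα𝔤 ha2 hαa)
                    (towerData_hαw (p := p) hαw)
                    (towerData_hαπ (p := p) hαπ) E hmono (r + 1)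
                  (fun i ↦ hE (i + (r + 1)))
                      (towerDataOffset_hdegE hf E hE hdeg) b.2.1 b.2.2.1 (fun i ↦
                      (towerDataOffset_hinert_of_level h𝔤0 hv hv' hvv' hw𝔤 hp.out hpv' hpv'2 hπ hα0 hα𝔤 hαf hℓ hαℓ ha2 hαa hfo E hE (r + 1) (finrank_add_offset_eq E hf hdeg)) (i + 1))
                      (towerDataOffset_hcount h𝔤0 hv' hvv' hw𝔤 hp.out hdeg1 hpv' hpv'2 E hdeg) (x b) (hx b)))
              (one_mem_closure_unitsGen hπ E _) (mul_mem_closure_unitsGen hπ E _) (inv_mem_closure_unitsGen hπ E _)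
              (galAct_mem_closure_unitsGen hπ E _ (galAct_mem_closure_unitsGen_of_mul_rule hπ E hmono _ σ
                (happrox_of_isLocArtinLiftable
                    (mul_ne_zero h𝔤0 (pow_ne_zero ν v'.ne_bot))
                    (not_mul_pow_le₃₂ hv hvv' ν) hvv'
                    (hw_of_towerData hw𝔤) hπ
                    (towerData_hα0 (p := p) hα0)
                    (towerData_hα𝔪 hv' hp.out hpv' hpv'2 hα𝔤 ha2 hαa)
                    (towerData_hαw (p := p) hαw)
                    (towerData_hαπ (p := p) hαπ) E hmono hE (r + 1)
                    (towerDataOffset_hdegE hf E hE hdeg)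
                    (towerDataOffset_hinert_of_level h𝔤0 hv hv' hvv' hw𝔤 hp.out hpv' hpv'2 hπ hα0 hα𝔤 hαf hℓ hαℓ ha2 hαa hfo E hE (r + 1) (finrank_add_offset_eq E hf hdeg))
                    (towerDataOffset_hcount h𝔤0 hv' hvv' hw𝔤 hp.out hdeg1 hpv' hpv'2 E hdeg) σ hσ)
                (fun a b ↦ ⟨a.1 * b.1, a.2.mul b.2⟩)
                (fun b ↦ Ideal.absNorm (b.1 : Ideal (𝓞 K)))
                (hrule_ellipticUnitsPrincipal₂ h24iii h25 hK ιK
                    (mul_ne_zero h𝔤0 (pow_ne_zero ν v'.ne_bot))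
                    (not_mul_pow_le₃₂ hv hvv' ν) hvv'
                    (hw_of_towerData hw𝔤) hπ
                    (towerData_hα0 (p := p) hα0)
                    (towerData_hα𝔪 hv' hp.out hpv' hpv'2 hα𝔤 ha2 hαa)
                    (towerData_hαw (p := p) hαw)
                    (towerData_hαπ (p := p) hαπ) E hmono (r + 1) (fun i ↦ hE (i + (r + 1)))
                    (towerDataOffset_hdegE hf E hE hdeg) h24ii
                  Subtype.val (fun a b ↦ ⟨a.1 * b.1, a.2.mul b.2⟩) (fun _ _ ↦ rfl) (fun a ↦ a.2.1) (fun a ↦ a.2.2.1) x hx σ hσ))))) =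
      Ideal.span {L} := by
  haveI hCZ : CharZero (v.adicCompletion K) := charZero_of_injective_algebraMap (algebraMap K (v.adicCompletion K)).injective
  have hex : exists_isAbsArithFrob (F := v.adicCompletion K) := exists_isAbsArithFrob_holds (v.adicCompletion K)
  obtain ⟨σ₀, hσ₀⟩ := hex
  -- `v̄` of degree one
  have hdeg1 : Nat.card (𝓞 K ⧸ v'.asIdeal) = p := natCard_quotient_eq_of_mem_of_mem_of_ne hK.1 hp.out hpv' hpv hvv'.symm
  have hpv'2 : ((p : ℕ) : 𝓞 K) ∉ v'.asIdeal ^ 2 := natCast_not_mem_sq_of_mem_of_mem_of_ne hK.1 hp.out hpv' hpv hvv'.symm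
  -- `v` of degree one: `𝒪_v ≅ ℤ_p`, `#𝓀(K_v) = p`, `p` a uniformiser
  have hqp : residueFieldCard (v.adicCompletion K) = p :=
    residueFieldCard_adicCompletion_of_padicIntEquiv v (padicIntEquivOfSplit K hK.1 hpv hpv' hvv')
  have h2p := isUniformizer_natCast_adicCompletion_of_padicIntEquiv v (padicIntEquivOfSplit K hK.1 hpv hpv' hvv')
  have hq : residueFieldCard (v.adicCompletion K) = 2 := by rw [hqp, hp2]
  have h2 : (valuation (v.adicCompletion K)).IsUniformizer ((((2 : ℕ) : 𝒪[v.adicCompletion K]) : v.adicCompletion K)) := by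
    have h := h2p
    rw [hp2] at h
    exact h
  have hspan : Ideal.span {(p : 𝒪[v.adicCompletion K])} = 𝓂[v.adicCompletion K] := by
    ext x
    rw [Ideal.mem_span_singleton, uniformizer_dvd_iff_mem_maximalIdeal h2p]
  haveI hAC : IsAdicComplete (Ideal.span {(p : 𝒪[v.adicCompletion K])}) 𝒪[v.adicCompletion K] := by
    rw [hspan]; infer_instance
  have hI : Ideal.span {(p : 𝒪[v.adicCompletion K])} ≠ ⊤ := by
    rw [hspan]; exact (IsLocalRing.maximalIdeal.isMaximal _).ne_top
  have hN : DenseRange (Nat.cast : ℕ → 𝒪[v.adicCompletion K]) := denseRange_natCast_of_isUniformizer_natCast (p := p) hqp h2p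
  -- `w_{𝔤₀} = 1`: units are torsion, hence `±1` in `K_v`, and `−1 ≢ 1 mod 𝔤₀` since `2 ∉ 𝔤₀`
  have hfin : ∀ uu : (𝓞 K)ˣ, IsOfFinOrder uu := isOfFinOrder_units_of_rank_eq_zero (rank_eq_zero_of_finrank_eq_two hK.1)
  have hinj : Function.Injective (algebraMap K (v.adicCompletion K)) := (algebraMap K (v.adicCompletion K)).injective
  have hw𝔤 : ∀ uu : (𝓞 K)ˣ, (uu : 𝓞 K) - 1 ∈ 𝔤₀ → uu = 1 := by
    intro uu huu
    rcases coe_units_eq_one_or_eq_neg_one_of_isOfFinOrder hq h2 (hfin uu) with h1 | h1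
    · have hK1 : ((uu : 𝓞 K) : K) = 1 := by
        apply hinj
        rw [map_one]
        exact h1
      exact Units.ext (NumberField.RingOfIntegers.coe_injective (by push_cast; exact hK1))
    · exfalso
      have hK1 : ((uu : 𝓞 K) : K) = -1 := by
        apply hinj
        rw [map_neg, map_one]
        exact h1
      have hO : (uu : 𝓞 K) = -1 := NumberField.RingOfIntegers.coe_injective (by push_cast; exact hK1)
      apply h2𝔤
      have e2 : (2 : 𝓞 K) = -((uu : 𝓞 K) - 1) := by rw [hO]; norm_num
      rw [e2]
      exact neg_mem huu
  refine ⟨hw𝔤, hdeg1, hpv'2, hCZ, σ₀, hσ₀, hq, hAC, hI, hN, ?_⟩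
  exact exists_frame_charIdeal_coinvariants_colemanImageTrace_closure_ellipticUnits_eq_span_of_ellipticUnits_moment h24iii h25 h24ii hK ιK
    h𝔤0 hv hv' hvv' hw𝔤 hdeg1 hpv' hpv'2 hσ₀ hq hI hN hp2 hcl h2

end Capstone

end Summit.BirchSwinnertonDyer.BirchSwinnertonDyer.Theorems.PrintCf2.ColemanCoinvariantTraceEllipticUnitsFrameDischargedSplit

end
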